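import Literature.Analysis.UnboundedOperators.LinearizedBoltzmannGainForms
import Literature.MathematicalPhysics.KineticTheory.TaggedSphereGainSchur
import HarnessLib

/-!
# Pointwise bounds for the gain part of the linearised hard-sphere operator in `ℝ³`

For the linearised hard-sphere operator around the normalised Maxwellian `M` on
`ℝ³ = EuclideanSpace ℝ (Fin 3)` (`LinearizedBoltzmann.lean`, Grad's splitting `L = -ν + K`,
`LinearizedBoltzmannOperator.lean`), the first gain part `(K₂' u)(v) = ∫∫ ((v - v_*)·ω)₊ M(v_*) u(v') dω dv_*`
is an integral operator with Hilbert's/Carleman's kernel `k(v, u)` (in the tree for the tagged-sphere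
operator: `KineticTheory.lintegral_gain_eq_carleman`, `KineticTheory.carlemanKernel 1`), which in
dimension `3` satisfies Grad's bound `M(v) k(v, u) ≤ G(u) √(M(v) M(v + u))` with `G ∈ L²(ℝ³)`
(`KineticTheory.maxwellianBeta_mul_carlemanKernel_le`, `G = gradRadial 1`). Consequently
(`lintegral_gain_fst_le`), for every `v` and every measurable `U ≥ 0`,

`∫∫ ((v - v_*)·ω)₊ M(v_*) U(v') dω dv_* ≤ M(v)^{-1/2} ‖G‖_{L²} (∫ U² dM)^{1/2}`,

so that `(K₂' u)(v)` converges absolutely **for every `v`** as soon as `u ∈ L²(M dv)`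
(`lintegral_gain_fst_enorm_lt_top`), with the Gaussian bound `|K₂' u (v)| ≤ C e^{|v|²/4} ‖u‖_{L²(M)}`.
This is the three-dimensional input (CIP 1994 §7.2, Thm 7.2.3: `K` maps `L²` into bounded — here
locally bounded in the `L²(M dv)` picture — functions) for the pointwise (everywhere) representative
of `L⁻¹ g` in the Chapman–Enskog theory. No new definitions are introduced.
-/

open MeasureTheory Metric Real Set Filter ProbabilityTheory Module
open scoped ENNReal InnerProductSpace

namespace Literature.Analysis.UnboundedOperators

noncomputable section

open Literature.MathematicalPhysics.KineticTheory (sphereMeasure hardSphereKernel collide carlemanKernel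
  gradRadial lintegral_gain_eq_carleman maxwellianBeta_mul_carlemanKernel_le carlemanKernel_nonneg
  gradRadial_nonneg)
open Literature.Analysis.FluidPDE (globalMaxwellian globalMaxwellian_pos continuous_globalMaxwellian
  stdGaussian_eq_withDensity_globalMaxwellian_holds)
open Literature.Analysis.FunctionSpaces (maxwellianBeta maxwellianBeta_one)

/-! ### Grad's radial majorant is square integrable in dimension `3` -/

/-- `∫ G(u)² du < ∞` on `ℝ³` for `G(u) = (2π)^{-1/2} |u|⁻¹ e^{-|u|²/8}` (polar coordinates:
`r² · r⁻² e^{-r²/4}` is integrable on `(0, ∞)`). [folklore] -/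
theorem lintegral_gradRadial_sq_lt_top :
    ∫⁻ u : EuclideanSpace ℝ (Fin 3), ENNReal.ofReal (gradRadial 1 u ^ 2) < ∞ := by
  set c : ℝ := (Real.sqrt (2 * Real.pi * (1 : ℝ)⁻¹))⁻¹ with hc
  have hexp : ∀ r : ℝ, Real.exp (-(1 / 8) * r ^ 2) ^ 2 = Real.exp (-(1 / 4) * r ^ 2) := fun r => by
    rw [← Real.exp_nat_mul]; congr 1; push_cast; ring
  have hsq : ∀ u : EuclideanSpace ℝ (Fin 3), gradRadial 1 u ^ 2 =
      (fun r : ℝ => c ^ 2 * (r ^ 2)⁻¹ * Real.exp (-(1 / 4) * r ^ 2)) ‖u‖ := by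
    intro u
    simp only [gradRadial, Fintype.card_fin, show (3 : ℕ) - 2 = 1 from rfl, pow_one, ← hc]
    rw [mul_pow, mul_pow, inv_pow, inv_pow, hexp]
  have hint : Integrable (fun u : EuclideanSpace ℝ (Fin 3) =>
      (fun r : ℝ => c ^ 2 * (r ^ 2)⁻¹ * Real.exp (-(1 / 4) * r ^ 2)) ‖u‖) := by
    refine (integrable_fun_norm_addHaar (volume : Measure (EuclideanSpace ℝ (Fin 3)))
      (f := fun r : ℝ => c ^ 2 * (r ^ 2)⁻¹ * Real.exp (-(1 / 4) * r ^ 2))).2 ?_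
    rw [finrank_euclideanSpace_fin]
    have h : IntegrableOn (fun r : ℝ => c ^ 2 * Real.exp (-(1 / 4) * r ^ 2)) (Ioi 0) :=
      ((integrable_exp_neg_mul_sq (by norm_num : (0 : ℝ) < 1 / 4)).const_mul _).integrableOn
    refine h.congr_fun (fun r hr => ?_) measurableSet_Ioi
    have hr : (0 : ℝ) < r := hr
    simp only [smul_eq_mul, show (3 : ℕ) - 1 = 2 from rfl]
    field_simp
  refine lt_of_le_of_lt (lintegral_mono fun u => ?_) hint.lintegral_lt_top
  rw [hsq]

/-! ### The Carleman form and Grad's bound at `β = 1`, `d = 3` -/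

/-- **Carleman representation of the first gain term** of the linearised hard-sphere operator in
`ℝ³` (the tree's `KineticTheory.lintegral_gain_eq_carleman` at `β = 1`, `M_1 = M`):
`∫∫ ((v - v_*)·ω)₊ M(v_*) U(v') dω dv_* = ∫ k(v, u) U(v + u) du`. [folklore] -/
theorem lintegral_gain_fst_eq_carleman (v : EuclideanSpace ℝ (Fin 3))
    {U : EuclideanSpace ℝ (Fin 3) → ℝ≥0∞} (hU : Measurable U) :
    ∫⁻ w, ∫⁻ ω, ENNReal.ofReal (hardSphereKernel (v, w) ω * globalMaxwellian w) *
        U (collide ω (v, w)).1 ∂sphereMeasure =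
      ∫⁻ u, ENNReal.ofReal (carlemanKernel 1 v u) * U (v + u) := by
  have h := lintegral_gain_eq_carleman (d := Fin 3) (β := 1) (by simp) one_pos v hU
  simpa only [maxwellianBeta_one] using h

/-- Grad's bound at `β = 1`, `d = 3`: `k(v, u) ≤ M(v)^{-1/2} G(u) M(v + u)^{1/2}`. [folklore] -/
theorem carlemanKernel_one_le (v u : EuclideanSpace ℝ (Fin 3)) :
    carlemanKernel 1 v u ≤ (Real.sqrt (globalMaxwellian v))⁻¹ * gradRadial 1 u *
      Real.sqrt (globalMaxwellian (v + u)) := by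
  have h := maxwellianBeta_mul_carlemanKernel_le (d := Fin 3) one_pos v u
  simp only [maxwellianBeta_one] at h
  have hM := globalMaxwellian_pos v
  have hsM : 0 < Real.sqrt (globalMaxwellian v) := Real.sqrt_pos.2 hM
  rw [Real.sqrt_mul hM.le] at h
  -- divide Grad's bound by `M(v) = √M(v) √M(v)`
  have hG : (Real.sqrt (2 * Real.pi * (1 : ℝ)⁻¹))⁻¹ * (‖u‖ ^ (Fintype.card (Fin 3) - 2))⁻¹ *
      Real.exp (-(1 / 8) * ‖u‖ ^ 2) = gradRadial 1 u := rfl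
  rw [hG] at h
  have h2 : Real.sqrt (globalMaxwellian v) * (Real.sqrt (globalMaxwellian v) * carlemanKernel 1 v u) ≤
      Real.sqrt (globalMaxwellian v) * (gradRadial 1 u * Real.sqrt (globalMaxwellian (v + u))) := by
    calc Real.sqrt (globalMaxwellian v) * (Real.sqrt (globalMaxwellian v) * carlemanKernel 1 v u)
        = globalMaxwellian v * carlemanKernel 1 v u := by
          rw [← mul_assoc, Real.mul_self_sqrt hM.le]
      _ ≤ gradRadial 1 u * (Real.sqrt (globalMaxwellian v) * Real.sqrt (globalMaxwellian (v + u))) := h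
      _ = _ := by ring
  have h3 := le_of_mul_le_mul_left h2 hsM
  calc carlemanKernel 1 v u
      = (Real.sqrt (globalMaxwellian v))⁻¹ * (Real.sqrt (globalMaxwellian v) * carlemanKernel 1 v u) := by
        rw [← mul_assoc, inv_mul_cancel₀ hsM.ne', one_mul]
    _ ≤ (Real.sqrt (globalMaxwellian v))⁻¹ * (gradRadial 1 u * Real.sqrt (globalMaxwellian (v + u))) :=
        mul_le_mul_of_nonneg_left h3 (inv_nonneg.2 hsM.le)
    _ = _ := by ring

/-- **Pointwise `L²(M)`-bound on the first gain term in `ℝ³`** (Carleman form, Grad's bound and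
Cauchy–Schwarz): for every `v` and measurable `U ≥ 0`,
`∫∫ ((v - v_*)·ω)₊ M(v_*) U(v') dω dv_* ≤ M(v)^{-1/2} (∫ G²)^{1/2} (∫ M U²)^{1/2}`.
[folklore] -/
theorem lintegral_gain_fst_le (v : EuclideanSpace ℝ (Fin 3))
    {U : EuclideanSpace ℝ (Fin 3) → ℝ≥0∞} (hU : Measurable U) :
    ∫⁻ w, ∫⁻ ω, ENNReal.ofReal (hardSphereKernel (v, w) ω * globalMaxwellian w) *
        U (collide ω (v, w)).1 ∂sphereMeasure ≤
      ENNReal.ofReal ((Real.sqrt (globalMaxwellian v))⁻¹) *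
        ((∫⁻ u : EuclideanSpace ℝ (Fin 3), ENNReal.ofReal (gradRadial 1 u ^ 2)) ^ (1 / 2 : ℝ) *
          (∫⁻ y, ENNReal.ofReal (globalMaxwellian y) * U y ^ 2) ^ (1 / 2 : ℝ)) := by
  rw [lintegral_gain_fst_eq_carleman v hU]
  have hsM : 0 ≤ (Real.sqrt (globalMaxwellian v))⁻¹ := inv_nonneg.2 (Real.sqrt_nonneg _)
  -- pointwise: `k U(v+u) ≤ M(v)^{-1/2} · (G(u) · (√M(v+u) U(v+u)))`
  have hpt : ∀ u, ENNReal.ofReal (carlemanKernel 1 v u) * U (v + u) ≤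
      ENNReal.ofReal ((Real.sqrt (globalMaxwellian v))⁻¹) *
        (ENNReal.ofReal (gradRadial 1 u) *
          (ENNReal.ofReal (Real.sqrt (globalMaxwellian (v + u))) * U (v + u))) := by
    intro u
    rw [← mul_assoc, ← mul_assoc, ← ENNReal.ofReal_mul hsM,
      ← ENNReal.ofReal_mul (mul_nonneg hsM (gradRadial_nonneg 1 u))]
    exact mul_le_mul' (ENNReal.ofReal_le_ofReal (carlemanKernel_one_le v u)) le_rfl
  refine (lintegral_mono hpt).trans ?_
  have hGm : Measurable fun u : EuclideanSpace ℝ (Fin 3) => ENNReal.ofReal (gradRadial 1 u) :=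
    (Literature.MathematicalPhysics.KineticTheory.measurable_gradRadial 1).ennreal_ofReal
  have hVm : Measurable fun u : EuclideanSpace ℝ (Fin 3) =>
      ENNReal.ofReal (Real.sqrt (globalMaxwellian (v + u))) * U (v + u) :=
    ((continuous_globalMaxwellian.comp (continuous_const.add continuous_id)).measurable.sqrt.ennreal_ofReal).mul
      (hU.comp (measurable_const_add v))
  rw [lintegral_const_mul _ (show Measurable (fun u : EuclideanSpace ℝ (Fin 3) =>
      ENNReal.ofReal (gradRadial 1 u) * (ENNReal.ofReal (Real.sqrt (globalMaxwellian (v + u))) * U (v + u)))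
    from hGm.mul hVm)]
  refine mul_le_mul' le_rfl ?_
  -- Cauchy–Schwarz
  have hCS := ENNReal.lintegral_mul_le_Lp_mul_Lq (volume : Measure (EuclideanSpace ℝ (Fin 3)))
    Real.HolderConjugate.two_two hGm.aemeasurable hVm.aemeasurable
  refine hCS.trans (le_of_eq ?_)
  congr 2
  · refine lintegral_congr fun u => ?_
    rw [show ((2 : ℝ)) = ((2 : ℕ) : ℝ) by norm_num, ENNReal.rpow_natCast,
      ← ENNReal.ofReal_pow (gradRadial_nonneg 1 u)]
  · rw [← lintegral_add_left_eq_self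
      (fun y : EuclideanSpace ℝ (Fin 3) => ENNReal.ofReal (globalMaxwellian y) * U y ^ 2) v]
    refine lintegral_congr fun u => ?_
    rw [ENNReal.mul_rpow_of_nonneg _ _ (by norm_num : (0 : ℝ) ≤ 2),
      show ((2 : ℝ)) = ((2 : ℕ) : ℝ) by norm_num, ENNReal.rpow_natCast, ENNReal.rpow_natCast,
      ← ENNReal.ofReal_pow (Real.sqrt_nonneg _), Real.sq_sqrt (globalMaxwellian_pos _).le]

/-- **The first gain term converges absolutely at every velocity for `u ∈ L²(M dv)`** (`ℝ³`):
`∫∫ ((v - v_*)·ω)₊ M(v_*) |u(v')| dω dv_* ≤ M(v)^{-1/2} ‖G‖_{L²} ‖u‖_{L²(M)} < ∞`. [folklore] -/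
theorem lintegral_gain_fst_enorm_le (v : EuclideanSpace ℝ (Fin 3)) {u : EuclideanSpace ℝ (Fin 3) → ℝ}
    (hu : Measurable u) :
    ∫⁻ w, ∫⁻ ω, ENNReal.ofReal (hardSphereKernel (v, w) ω * globalMaxwellian w) *
        ‖u (collide ω (v, w)).1‖ₑ ∂sphereMeasure ≤
      ENNReal.ofReal ((Real.sqrt (globalMaxwellian v))⁻¹) *
        ((∫⁻ u : EuclideanSpace ℝ (Fin 3), ENNReal.ofReal (gradRadial 1 u ^ 2)) ^ (1 / 2 : ℝ) *
          eLpNorm u 2 (stdGaussian (EuclideanSpace ℝ (Fin 3)))) := by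
  have h := lintegral_gain_fst_le v hu.enorm
  rw [lintegral_globalMaxwellian_mul_enorm_sq_rpow hu.aestronglyMeasurable] at h
  exact h
where
  /-- `(∫ M |u|²)^{1/2} = ‖u‖_{L²(M)}` (auxiliary restatement of
  `lintegral_globalMaxwellian_mul_enorm_sq`). [folklore] -/
  lintegral_globalMaxwellian_mul_enorm_sq_rpow {u : EuclideanSpace ℝ (Fin 3) → ℝ}
      (hu : AEStronglyMeasurable u (stdGaussian (EuclideanSpace ℝ (Fin 3)))) :
      (∫⁻ y, ENNReal.ofReal (globalMaxwellian y) * ‖u y‖ₑ ^ 2) ^ (1 / 2 : ℝ) =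
        eLpNorm u 2 (stdGaussian (EuclideanSpace ℝ (Fin 3))) := by
    have h := lintegral_globalMaxwellian_mul_enorm_sq (E := EuclideanSpace ℝ (Fin 3)) hu
    have h' : (∫⁻ y, ENNReal.ofReal (globalMaxwellian y) * ‖u y‖ₑ ^ 2) =
        eLpNorm u 2 (stdGaussian (EuclideanSpace ℝ (Fin 3))) ^ (2 : ℝ) := by
      rw [← h]
      refine lintegral_congr fun y => ?_
      rw [show ((2 : ℝ)) = ((2 : ℕ) : ℝ) by norm_num, ENNReal.rpow_natCast]
    rw [h', ← ENNReal.rpow_mul]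
    norm_num

end

end Literature.Analysis.UnboundedOperators
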